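import Summits.BirchSwinnertonDyer.BirchSwinnertonDyer.Theorems.ManinLocalTwoThreeParamPoleJRationalRelation
import Summits.BirchSwinnertonDyer.BirchSwinnertonDyer.Theorems.ManinLocalTwoThreeParamPoleJKiller
import Summits.BirchSwinnertonDyer.Rank1Residual.ManinAdditive.UDCKummerWitnessLine
import HarnessLib

/-!
# (ALG) `KummerPoleValuesAlgebraic`: one integer polynomial kills `j` on the fibres over `y_W = 0`

Cell `bsd-f2-manin`, prover seat p3 (gen 16), crux C3 `ManinPrimeToThreeAtNine` (stmt-22968), skeleton v25 stub
`stub_kummerPoleValuesAlgebraic` = `UDCKummerWitnessLine.KummerPoleValuesAlgebraic` BY NAME.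

Proof.  Let `c ≠ 0` (else the hypothesis `c·u(τ) ∉ Λ_W` is void), `Λ' = c⁻¹Λ_W ⊇ Λ_f`, so `x := ℘_{Λ'}(u) = shortX` and
`℘'_{Λ'}(u) = 2·shortY`.  Take the explicit presentation `x·G = F` (`…ParamPoleJTwist`) and a rational relation
`Σ y(i,k) jᵏ xⁱ = 0` non-degenerate in `x` (`…ParamPoleJRationalRelation`).  At `τ ∈ B` (`c·u ∉ Λ_W`, `y_W(φτ) = 0`):
`α = x(τ)` is a root of the rational cubic `R(X) = 4X³ − g₂'X − g₃' − (a₁c(X − c²b₂/12) + c³a₃)²` (Weierstrass equation +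
`minimalY = 0`), and — if `G(τ) ≠ 0` — `j(τ)` is a root of the NONZERO polynomial `Φ(J, α)` obtained by evaluating the relation
(`sum_kleinJ_pow_mul_weierstrassP_pow_eq_zero`: a modular form with zero `q`-expansion vanishes pointwise); if `G(τ) = 0` then
`j(τ) = j(s)` for a pole `s`.  So `j(B)` lies in a FINITE set of algebraic numbers (roots of `Φ(J, α)`, `α ∈ roots R`, are algebraic
over `ℚ(α)`, hence over `ℚ`; `j(poles)` is algebraic by `…ParamPoleJAlgebraic`), killed by one `P ∈ ℤ[X] ∖ 0`.
Everything is proved; no named fact.  BSD is not proved by this; C2/C3 are not proved by this.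
-/

set_option linter.dupNamespace false

noncomputable section

open Complex Filter Topology Set Function
open UpperHalfPlane hiding I
open scoped Real Topology Manifold MatrixGroups PeriodPair ModularForm IntermediateField
open ModularForm EisensteinSeries SlashInvariantForm ModularFormClass CongruenceSubgroup PowerSeries
open Literature.NumberTheory.EllipticCurves Literature.NumberTheory.EllipticCurves.ModularForms
open Summit.BirchSwinnertonDyer.Rank1Residual.ManinAdditive
open Summit.BirchSwinnertonDyer.Rank1Residual.ManinAdditive.KummerCubeMonodromy
open Summit.BirchSwinnertonDyer.Rank1Residual.ManinAdditive.UDCKummerWitnessLine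

namespace Summit.BirchSwinnertonDyer.BirchSwinnertonDyer.Theorems.ManinLocalTwoThree.ParamPoleJ

variable {N : ℕ} [NeZero N]

/-! ### §1 Evaluating the relation at a point -/

/-- **Evaluation of a `j`–`x` relation at a point.**  If `Σ y(i,k)·ĵᵏ·x̂ⁱ = 0` in `ℂ((q))` for a presentation `x·G = F`,
then `Σ y(i,k)·j(τ)ᵏ·℘_Λ(u(τ))ⁱ = 0` at every `τ` off the poles with `G(τ) ≠ 0` (clear denominators by `Δ̂^D·Ĝ^d`:
the modular form `Σ y(i,k) E₄^{3k}Δ^{D−k}FⁱG^{d−i}` has zero `q`-expansion, hence vanishes). [folklore] -/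
theorem sum_kleinJ_pow_mul_weierstrassP_pow_eq_zero {f : CuspForm (Gamma0 N) 2} {L : PeriodPair} {k : ℤ}
    {F G : CuspForm (Gamma0 N) k} (h : IsXPresentation f L F G) {d D : ℕ} {y : Fin (d + 1) × Fin (D + 1) → ℚ}
    (hrel : ∑ p : Fin (d + 1) × Fin (D + 1), HahnSeries.C ((y p : ℚ) : ℂ) *
      (kleinJL ^ (p.2 : ℕ) * ((h.xFn : modularFunctionField N) : LaurentSeries ℂ) ^ (p.1 : ℕ)) = 0)
    {τ : ℍ} (hτ : eichlerIntegral f τ ∉ L.lattice) (hG : G τ ≠ 0) :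
    ∑ p : Fin (d + 1) × Fin (D + 1), ((y p : ℚ) : ℂ) *
      (kleinJ τ ^ (p.2 : ℕ) * ℘[L] (eichlerIntegral f τ) ^ (p.1 : ℕ)) = 0 := by
  classical
  set X : LaurentSeries ℂ := ((h.xFn : modularFunctionField N) : LaurentSeries ℂ) with hXdef
  set A : ModularForm (Gamma0 N) 12 := ofLevelOne (Gamma0 N) E₄cube with hA
  set Dl : ModularForm (Gamma0 N) 12 := ofLevelOne (Gamma0 N) delta with hDl
  set Fm : ModularForm (Gamma0 N) k := (F : ModularForm (Gamma0 N) k) with hFm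
  set Gm : ModularForm (Gamma0 N) k := (G : ModularForm (Gamma0 N) k) with hGm
  -- the forms `E₄^{3t} Δ^{D-t} F^i G^{d-i}` of weight `12 D + d k`
  let B : Fin (d + 1) × Fin (D + 1) → ModularForm (Gamma0 N) ((D : ℤ) * 12 + (d : ℤ) * k) := fun p ↦
    (((A.pow p.2).mul (Dl.pow (D - p.2))).mcast (natCast_mul_add_natCast_sub_mul (Nat.lt_succ_iff.mp p.2.isLt) 12)).mul
      (((Fm.pow p.1).mul (Gm.pow (d - p.1))).mcast (natCast_mul_add_natCast_sub_mul (Nat.lt_succ_iff.mp p.1.isLt) k))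
  set H : ModularForm (Gamma0 N) ((D : ℤ) * 12 + (d : ℤ) * k) := ∑ p, ((y p : ℚ) : ℂ) • B p with hH
  -- `q`-expansions
  have hD0 : qExpansionL N Dl ≠ 0 := fun h0 ↦ by
    rw [qExpansionL_eq_zero_iff] at h0
    have := congrArg (fun F : ModularForm (Gamma0 N) 12 ↦ F UpperHalfPlane.I) h0
    simp only [hDl, coe_ofLevelOne, delta_apply, ModularForm.zero_apply] at this
    exact ModularForm.discriminant_ne_zero _ this
  have hG0 : qExpansionL N Gm ≠ 0 := (qExpansionL_eq_zero_iff N Gm).not.mpr h.modularForm_ne_zero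
  have hu : X * qExpansionL N Gm = qExpansionL N Fm := mkFn_mul _ _ h.modularForm_ne_zero
  have hj : kleinJL * qExpansionL N Dl = qExpansionL N A := by
    rw [show kleinJL = qExpansionL N A / qExpansionL N Dl from rfl, div_mul_cancel₀ _ hD0]
  have hB : ∀ p : Fin (d + 1) × Fin (D + 1), qExpansionL N (B p) =
      (kleinJL ^ (p.2 : ℕ) * X ^ (p.1 : ℕ)) * (qExpansionL N Dl ^ D * qExpansionL N Gm ^ d) := by
    intro p
    have eD : qExpansionL N Dl ^ D = qExpansionL N Dl ^ (p.2 : ℕ) * qExpansionL N Dl ^ (D - p.2) := by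
      rw [← pow_add, Nat.add_sub_cancel' (Nat.lt_succ_iff.mp p.2.isLt)]
    have eG : qExpansionL N Gm ^ d = qExpansionL N Gm ^ (p.1 : ℕ) * qExpansionL N Gm ^ (d - p.1) := by
      rw [← pow_add, Nat.add_sub_cancel' (Nat.lt_succ_iff.mp p.1.isLt)]
    simp only [B, qExpansionL_mul, qExpansionL_mcast, qExpansionL_pow]
    rw [← hj, ← hu, eD, eG]
    ring
  have hHq : qExpansionL N H = 0 := by
    have : qExpansionL N H = ∑ p, ((y p : ℚ) : ℂ) • qExpansionL N (B p) := by
      rw [hH, ← qExpansionLₗ_apply, map_sum]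
      simp only [map_smul, qExpansionLₗ_apply]
    rw [this]
    calc ∑ p, ((y p : ℚ) : ℂ) • qExpansionL N (B p)
        = (∑ p : Fin (d + 1) × Fin (D + 1), HahnSeries.C ((y p : ℚ) : ℂ) * (kleinJL ^ (p.2 : ℕ) * X ^ (p.1 : ℕ))) *
            (qExpansionL N Dl ^ D * qExpansionL N Gm ^ d) := by
          rw [Finset.sum_mul]
          refine Finset.sum_congr rfl fun p _ ↦ ?_
          rw [hB, ← HahnSeries.C_mul_eq_smul]
          ring
      _ = 0 := by rw [hrel, zero_mul]
  have hH0 : H = 0 := (qExpansionL_eq_zero_iff N H).mp hHq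
  -- pointwise at `τ`
  have hHτ : H τ = 0 := by rw [hH0]; rfl
  set x : ℂ := ℘[L] (eichlerIntegral f τ) with hx
  have hFτ : F τ = x * G τ := (h.2 τ hτ).symm
  have hAτ : A τ = kleinJ τ * ModularForm.discriminant τ := by
    rw [hA, coe_ofLevelOne, E₄cube_apply, E₄_cube_eq_kleinJ_mul]
  have hDτ : Dl τ = ModularForm.discriminant τ := by rw [hDl, coe_ofLevelOne, delta_apply]
  have hBτ : ∀ p : Fin (d + 1) × Fin (D + 1), B p τ =
      (kleinJ τ ^ (p.2 : ℕ) * x ^ (p.1 : ℕ)) * (ModularForm.discriminant τ ^ D * G τ ^ d) := by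
    intro p
    have eD : ModularForm.discriminant τ ^ D =
        ModularForm.discriminant τ ^ (p.2 : ℕ) * ModularForm.discriminant τ ^ (D - p.2) := by
      rw [← pow_add, Nat.add_sub_cancel' (Nat.lt_succ_iff.mp p.2.isLt)]
    have eG : G τ ^ d = G τ ^ (p.1 : ℕ) * G τ ^ (d - p.1) := by
      rw [← pow_add, Nat.add_sub_cancel' (Nat.lt_succ_iff.mp p.1.isLt)]
    simp only [B, ModularForm.coe_mul, ModularForm.coe_mcast, ModularForm.coe_pow, Pi.mul_apply, Pi.pow_apply]
    rw [hAτ, hDτ, show Fm τ = F τ from rfl, show Gm τ = G τ from rfl, hFτ, eD, eG]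
    ring
  have hsum : H τ = (∑ p : Fin (d + 1) × Fin (D + 1), ((y p : ℚ) : ℂ) * (kleinJ τ ^ (p.2 : ℕ) * x ^ (p.1 : ℕ))) *
      (ModularForm.discriminant τ ^ D * G τ ^ d) := by
    rw [hH, coe_finset_sum, Finset.sum_apply, Finset.sum_mul]
    refine Finset.sum_congr rfl fun p _ ↦ ?_
    rw [IsGLPos.smul_apply, smul_eq_mul, hBτ]
    ring
  rw [hsum] at hHτ
  exact (mul_eq_zero.mp hHτ).resolve_right
    (mul_ne_zero (pow_ne_zero _ (ModularForm.discriminant_ne_zero τ)) (pow_ne_zero _ hG))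

/-! ### §2 Auxiliary algebra -/

omit [NeZero N] in
/-- Zeros of the explicit annihilator have `j`-value in `j(S)`. [folklore] -/
theorem exists_kleinJ_eq_of_twistFun_eq_zero {S : Finset ℍ} {n : ℍ → ℕ} {a : ℕ} {τ : ℍ}
    (h0 : twistFun S n a (fun s ↦ ModularForm.discriminant s) (fun s ↦ E₄ s ^ 3) τ = 0) :
    ∃ s ∈ S, kleinJ τ = kleinJ s := by
  rw [twistFun, mul_eq_zero] at h0
  rcases h0 with h0 | h0
  · exact absurd (pow_eq_zero_iff'.mp h0).1 (ModularForm.discriminant_ne_zero τ)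
  · obtain ⟨s, hs, hz⟩ := Finset.prod_eq_zero_iff.mp h0
    refine ⟨s, hs, ?_⟩
    have hb := (pow_eq_zero_iff'.mp hz).1
    rw [kleinJ, kleinJ, div_eq_div_iff (ModularForm.discriminant_ne_zero τ) (ModularForm.discriminant_ne_zero s)]
    linear_combination hb

omit [NeZero N] in
/-- Coefficients of `Σ_{i ≤ e} C(yᵢ)Xⁱ` (any semiring). [folklore] -/
theorem coeff_sum_C_mul_X_pow' {R : Type*} [Semiring R] {e : ℕ} (y : Fin (e + 1) → R) (i : Fin (e + 1)) :
    (∑ i' : Fin (e + 1), Polynomial.C (y i') * Polynomial.X ^ (i' : ℕ)).coeff i = y i := by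
  rw [Polynomial.finsetSum_coeff]
  simp_rw [Polynomial.coeff_C_mul_X_pow]
  rw [Finset.sum_eq_single i (fun j _ hj ↦ if_neg (fun h ↦ hj (Fin.ext h.symm))) (by simp)]
  simp

omit [NeZero N] in
/-- **Roots of `Φ(J, α) = Σ_k c_k(α) Jᵏ` are algebraic when `α` is** (`c_k(α) ∈ ℚ(α)`, tower `ℚ ⊆ ℚ(α) ⊆ ℂ`). [folklore] -/
theorem isIntegral_of_eval_eq_zero_of_isIntegral {d D : ℕ} (y : Fin (d + 1) × Fin (D + 1) → ℚ) {α : ℂ}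
    (hα : IsIntegral ℚ α) (hnd : ∃ k : Fin (D + 1), ∑ i : Fin (d + 1), ((y (i, k) : ℚ) : ℂ) * α ^ (i : ℕ) ≠ 0)
    {β : ℂ} (hβ : (∑ k : Fin (D + 1), Polynomial.C (∑ i : Fin (d + 1), ((y (i, k) : ℚ) : ℂ) * α ^ (i : ℕ)) *
      Polynomial.X ^ (k : ℕ)).eval β = 0) : IsIntegral ℚ β := by
  classical
  haveI : FiniteDimensional ℚ ℚ⟮α⟯ := IntermediateField.adjoin.finiteDimensional hα
  haveI : Algebra.IsIntegral ℚ ℚ⟮α⟯ := Algebra.IsIntegral.of_finite ℚ ℚ⟮α⟯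
  have hmemk : ∀ k : Fin (D + 1), ∑ i : Fin (d + 1), ((y (i, k) : ℚ) : ℂ) * α ^ (i : ℕ) ∈ ℚ⟮α⟯ := fun k ↦ by
    refine sum_mem fun i _ ↦ mul_mem ?_ (pow_mem (IntermediateField.mem_adjoin_simple_self ℚ α) _)
    have := IntermediateField.algebraMap_mem ℚ⟮α⟯ (y (i, k))
    rwa [eq_ratCast] at this
  set ΦK : Polynomial ℚ⟮α⟯ := ∑ k : Fin (D + 1),
    Polynomial.C (⟨_, hmemk k⟩ : ℚ⟮α⟯) * Polynomial.X ^ (k : ℕ) with hΦK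
  have hΦK0 : ΦK ≠ 0 := by
    obtain ⟨k, hk⟩ := hnd
    intro h0
    have := coeff_sum_C_mul_X_pow' (fun k ↦ (⟨_, hmemk k⟩ : ℚ⟮α⟯)) k
    rw [← hΦK, h0, Polynomial.coeff_zero] at this
    exact hk (by simpa using (congrArg Subtype.val this).symm)
  have hΦKβ : Polynomial.aeval β ΦK = 0 := by
    rw [← hβ, hΦK, map_sum, Polynomial.eval_finsetSum]
    refine Finset.sum_congr rfl fun k _ ↦ ?_
    rw [map_mul, map_pow, Polynomial.aeval_C, Polynomial.aeval_X, Polynomial.eval_mul, Polynomial.eval_C,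
      Polynomial.eval_pow, Polynomial.eval_X]
    rfl
  have halg : IsAlgebraic ℚ⟮α⟯ β := ⟨ΦK, hΦK0, hΦKβ⟩
  exact isIntegral_trans β halg.isIntegral

/-! ### §3 (ALG) by name -/

/-- **(ALG) `KummerPoleValuesAlgebraic` — the v25 stub `stub_kummerPoleValuesAlgebraic` of line `kato_shift_three`,
closed BY NAME**: for every modular parametrisation datum `D` of an elliptic curve `W/ℚ` there is ONE nonzero integer
polynomial `P` with `P(j(τ)) = 0` at every `τ ∈ ℍ` with `c·u(τ) ∉ Λ_W` and `y_W(φ(τ)) = 0`.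
[cite: ShimuraIATAF1971, §6.2 Prop. 6.9, §2.4 Prop. 2.11 and Thm. 7.14] -/
theorem kummerPoleValuesAlgebraic_holds : UDCKummerWitnessLine.KummerPoleValuesAlgebraic := by
  intro W _ _ N _ D
  classical
  by_cases hc : D.c = 0
  · refine ⟨Polynomial.X, Polynomial.X_ne_zero, fun τ hτ _ ↦ ?_⟩
    exact (hτ (by rw [hc, Int.cast_zero, zero_mul]; exact zero_mem _)).elim
  -- the lattice `c⁻¹Λ_W ⊇ Λ_f` and the arithmetic data
  have hc0 : (D.c : ℂ) ≠ 0 := Int.cast_ne_zero.mpr hc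
  have hc' : ((D.c : ℂ))⁻¹ ≠ 0 := inv_ne_zero hc0
  set L' : PeriodPair := D.L.mulLeft ((D.c : ℂ))⁻¹ hc' with hL'
  have hmem : ∀ x : ℂ, x ∈ L'.lattice ↔ (D.c : ℂ) * x ∈ D.L.lattice := fun x ↦ by
    rw [hL', PeriodPair.mem_mulLeft_lattice, inv_inv]
  have hΛ : ∀ x ∈ periodLattice D.f, x ∈ L'.lattice := fun x hx ↦ (hmem x).mpr (D.smul_periodLattice_le x hx)
  have hf : D.f ≠ 0 := D.isNewformOf.1.ne_zero
  have hrat : ∀ m, ∃ q : ℚ, (q : ℂ) = cuspCoeff D.f m := fun m ↦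
    ⟨W.LFunction m, by rw [D.isNewformOf.2 m]; push_cast; rfl⟩
  obtain ⟨q₂, hq₂⟩ : ∃ q : ℚ, (q : ℂ) = L'.g₂ := by
    refine ⟨(D.c : ℚ) ^ 4 * (W.c₄ / 12), ?_⟩
    rw [hL', PeriodPair.g₂_mulLeft, D.isNeronLattice.1, inv_pow, inv_inv, WeierstrassCurve.baseChange,
      WeierstrassCurve.map_c₄, eq_ratCast]
    push_cast
    ring
  obtain ⟨q₃, hq₃⟩ : ∃ q : ℚ, (q : ℂ) = L'.g₃ := by
    refine ⟨(D.c : ℚ) ^ 6 * (W.c₆ / 216), ?_⟩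
    rw [hL', PeriodPair.g₃_mulLeft, D.isNeronLattice.2, inv_pow, inv_inv, WeierstrassCurve.baseChange,
      WeierstrassCurve.map_c₆, eq_ratCast]
    push_cast
    ring
  -- `℘_{Λ'}(u) = x_s`, `℘'_{Λ'}(u) = 2 y_s`
  have hPx : ∀ τ : ℍ, ℘[L'] (eichlerIntegral D.f τ) = shortX D τ := by
    intro τ
    have h1 := PeriodPair.weierstrassP_mulLeft ((D.c : ℂ))⁻¹ hc' D.L ((D.c : ℂ) * eichlerIntegral D.f τ)
    rw [← mul_assoc, inv_mul_cancel₀ hc0, one_mul] at h1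
    rw [shortX, h1, inv_pow, inv_inv]
  have hPy : ∀ τ : ℍ, ℘'[L'] (eichlerIntegral D.f τ) = 2 * shortY D τ := by
    intro τ
    have h1 := PeriodPair.derivWeierstrassP_mulLeft ((D.c : ℂ))⁻¹ hc' D.L ((D.c : ℂ) * eichlerIntegral D.f τ)
    rw [← mul_assoc, inv_mul_cancel₀ hc0, one_mul] at h1
    rw [shortY, h1, inv_pow, inv_inv]
    ring
  -- explicit presentation and a rational relation non-degenerate in `x`
  obtain ⟨S, n, a, ha, F, hSP, -, hpres⟩ := exists_explicit_presentation D.f hf L' hΛ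
  obtain ⟨d, Dd, y, -, hrel, hnd⟩ := exists_rat_relation_nondegenerate hpres hf hrat ⟨q₂, hq₂⟩ ⟨q₃, hq₃⟩
  -- the rational cubic satisfied by `x_s` on `B`
  set Rq : Polynomial ℚ := 4 * Polynomial.X ^ 3 - Polynomial.C q₂ * Polynomial.X - Polynomial.C q₃ -
    (Polynomial.C ((W.a₁ : ℚ) * D.c) * (Polynomial.X - Polynomial.C ((D.c : ℚ) ^ 2 * W.b₂ / 12)) +
      Polynomial.C ((D.c : ℚ) ^ 3 * W.a₃)) ^ 2 with hRq
  have hRq0 : Rq ≠ 0 := by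
    have h3 : (4 * Polynomial.X ^ 3 : Polynomial ℚ).natDegree = 3 := by
      rw [show (4 : Polynomial ℚ) = Polynomial.C 4 by rfl, Polynomial.natDegree_C_mul_X_pow 3 _ (by norm_num)]
    have hlin : (Polynomial.C ((W.a₁ : ℚ) * D.c) * (Polynomial.X - Polynomial.C ((D.c : ℚ) ^ 2 * W.b₂ / 12)) +
        Polynomial.C ((D.c : ℚ) ^ 3 * W.a₃)).natDegree ≤ 1 := by
      refine (Polynomial.natDegree_add_le _ _).trans (max_le ?_ ?_)
      · exact (Polynomial.natDegree_C_mul_le _ _).trans (by rw [Polynomial.natDegree_X_sub_C])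
      · rw [Polynomial.natDegree_C]; exact zero_le_one
    have hsq : ((Polynomial.C ((W.a₁ : ℚ) * D.c) * (Polynomial.X - Polynomial.C ((D.c : ℚ) ^ 2 * W.b₂ / 12)) +
        Polynomial.C ((D.c : ℚ) ^ 3 * W.a₃)) ^ 2).natDegree ≤ 2 := by
      refine (Polynomial.natDegree_pow_le).trans ?_
      omega
    have h12 : (4 * Polynomial.X ^ 3 - Polynomial.C q₂ * Polynomial.X - Polynomial.C q₃ : Polynomial ℚ).natDegree = 3 := by
      rw [sub_sub, Polynomial.natDegree_sub_eq_left_of_natDegree_lt] <;> rw [h3]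
      refine lt_of_le_of_lt (Polynomial.natDegree_add_le _ _) (max_lt ?_ ?_)
      · exact lt_of_le_of_lt (Polynomial.natDegree_C_mul_le _ _) (by rw [Polynomial.natDegree_X]; norm_num)
      · rw [Polynomial.natDegree_C]; norm_num
    intro h0
    have := Polynomial.natDegree_sub_eq_left_of_natDegree_lt (p := (4 * Polynomial.X ^ 3 - Polynomial.C q₂ * Polynomial.X -
      Polynomial.C q₃ : Polynomial ℚ)) (lt_of_le_of_lt hsq (by rw [h12]; norm_num))
    rw [← hRq, h0, Polynomial.natDegree_zero, h12] at this
    exact absurd this (by norm_num)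
  set Rc : Polynomial ℂ := Rq.map (algebraMap ℚ ℂ) with hRc
  have hRc0 : Rc ≠ 0 := (Polynomial.map_ne_zero_iff (algebraMap ℚ ℂ).injective).mpr hRq0
  have hroot : ∀ τ : ℍ, (D.c : ℂ) * eichlerIntegral D.f τ ∉ D.L.lattice → minimalY D τ = 0 →
      Polynomial.aeval (shortX D τ) Rq = 0 := by
    intro τ hτ hY
    have hτ' : eichlerIntegral D.f τ ∉ L'.lattice := fun h ↦ hτ ((hmem _).mp h)
    have hW := L'.derivWeierstrassP_sq (eichlerIntegral D.f τ) hτ'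
    rw [hPx, hPy, ← hq₂, ← hq₃] at hW
    have hY' : 2 * shortY D τ = (W.a₁ : ℂ) * D.c * (shortX D τ - (D.c : ℂ) ^ 2 * (W.b₂ : ℂ) / 12) +
        (D.c : ℂ) ^ 3 * (W.a₃ : ℂ) := by
      rw [minimalY] at hY
      linear_combination 2 * hY
    rw [hY'] at hW
    simp only [hRq, map_sub, map_mul, map_pow, map_add, Polynomial.aeval_C, Polynomial.aeval_X, eq_ratCast,
      map_ofNat]
    push_cast
    linear_combination -hW
  -- `Φ(J, α)` and its evaluation at points of `B`
  have hΦ0 : ∀ α : ℂ, (∑ k : Fin (Dd + 1), Polynomial.C (∑ i : Fin (d + 1), ((y (i, k) : ℚ) : ℂ) * α ^ (i : ℕ)) *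
      Polynomial.X ^ (k : ℕ)) ≠ 0 := by
    intro α h0
    obtain ⟨k, hk⟩ := hnd α
    have := coeff_sum_C_mul_X_pow' (fun k ↦ ∑ i : Fin (d + 1), ((y (i, k) : ℚ) : ℂ) * α ^ (i : ℕ)) k
    rw [h0, Polynomial.coeff_zero] at this
    exact hk this.symm
  have hΦeval : ∀ τ : ℍ, eichlerIntegral D.f τ ∉ L'.lattice →
      (twistCuspForm S n a (fun s ↦ ModularForm.discriminant s) (fun s ↦ E₄ s ^ 3) N ha) τ ≠ 0 →
      (∑ k : Fin (Dd + 1), Polynomial.C (∑ i : Fin (d + 1), ((y (i, k) : ℚ) : ℂ) * shortX D τ ^ (i : ℕ)) *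
        Polynomial.X ^ (k : ℕ)).eval (kleinJ τ) = 0 := by
    intro τ hτ hG
    have h := sum_kleinJ_pow_mul_weierstrassP_pow_eq_zero hpres hrel hτ hG
    rw [hPx] at h
    rw [Polynomial.eval_finsetSum, ← h, Fintype.sum_prod_type_right]
    refine Finset.sum_congr rfl fun k _ ↦ ?_
    rw [Polynomial.eval_mul, Polynomial.eval_C, Polynomial.eval_pow, Polynomial.eval_X, Finset.sum_mul]
    refine Finset.sum_congr rfl fun i _ ↦ ?_
    ring
  -- the finite candidate set of `j`-values and their algebraicity
  set T : Finset ℂ := S.image kleinJ ∪ Rc.roots.toFinset.biUnion (fun α ↦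
    (∑ k : Fin (Dd + 1), Polynomial.C (∑ i : Fin (d + 1), ((y (i, k) : ℚ) : ℂ) * α ^ (i : ℕ)) *
      Polynomial.X ^ (k : ℕ)).roots.toFinset) with hT
  have hTalg : ∀ β ∈ T, IsIntegral ℚ β := by
    intro β hβ
    rcases Finset.mem_union.mp hβ with hβ | hβ
    · obtain ⟨s, hs, rfl⟩ := Finset.mem_image.mp hβ
      exact isIntegral_kleinJ_of_eichlerIntegral_mem_lattice D.f hf hrat L' hΛ ⟨q₂, hq₂⟩ ⟨q₃, hq₃⟩ (hSP s hs)
    · obtain ⟨α, hα, hβ⟩ := Finset.mem_biUnion.mp hβ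
      rw [Multiset.mem_toFinset, Polynomial.mem_roots hRc0, Polynomial.IsRoot.def, hRc, Polynomial.eval_map,
        ← Polynomial.aeval_def] at hα
      rw [Multiset.mem_toFinset, Polynomial.mem_roots (hΦ0 α), Polynomial.IsRoot.def] at hβ
      have hαalg : IsAlgebraic ℚ α := ⟨Rq, hRq0, hα⟩
      exact isIntegral_of_eval_eq_zero_of_isIntegral y hαalg.isIntegral (hnd α) hβ
  have hTmem : ∀ τ : ℍ, (D.c : ℂ) * eichlerIntegral D.f τ ∉ D.L.lattice → minimalY D τ = 0 → kleinJ τ ∈ T := by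
    intro τ hτ hY
    have hτ' : eichlerIntegral D.f τ ∉ L'.lattice := fun h ↦ hτ ((hmem _).mp h)
    by_cases hG : (twistCuspForm S n a (fun s ↦ ModularForm.discriminant s) (fun s ↦ E₄ s ^ 3) N ha) τ = 0
    · obtain ⟨s, hs, hjs⟩ := exists_kleinJ_eq_of_twistFun_eq_zero hG
      exact Finset.mem_union_left _ (Finset.mem_image.mpr ⟨s, hs, hjs.symm⟩)
    · refine Finset.mem_union_right _ (Finset.mem_biUnion.mpr ⟨shortX D τ, ?_, ?_⟩)
      · rw [Multiset.mem_toFinset, Polynomial.mem_roots hRc0, Polynomial.IsRoot.def, hRc, Polynomial.eval_map,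
          ← Polynomial.aeval_def]
        exact hroot τ hτ hY
      · rw [Multiset.mem_toFinset, Polynomial.mem_roots (hΦ0 _), Polynomial.IsRoot.def]
        exact hΦeval τ hτ' hG
  -- one integer polynomial killing the finite set
  have hP : ∀ β ∈ T, ∃ Q : Polynomial ℤ, Q ≠ 0 ∧ Polynomial.aeval β Q = 0 := fun β hβ ↦
    (IsFractionRing.isAlgebraic_iff ℤ ℚ ℂ).mpr (hTalg β hβ).isAlgebraic
  choose! Q hQ0 hQ using hP
  refine ⟨∏ β ∈ T, Q β, Finset.prod_ne_zero_iff.mpr fun β hβ ↦ hQ0 β hβ, fun τ hτ hY ↦ ?_⟩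
  rw [show ModularForm.E₄ τ ^ 3 / ModularForm.discriminant τ = kleinJ τ from rfl,
    show Polynomial.eval₂ (Int.castRingHom ℂ) (kleinJ τ) (∏ β ∈ T, Q β) =
      Polynomial.aeval (kleinJ τ) (∏ β ∈ T, Q β) by rw [Polynomial.aeval_def, algebraMap_int_eq], map_prod]
  exact Finset.prod_eq_zero (hTmem τ hτ hY) (hQ _ (hTmem τ hτ hY))

end Summit.BirchSwinnertonDyer.BirchSwinnertonDyer.Theorems.ManinLocalTwoThree.ParamPoleJ

namespace Summit.BirchSwinnertonDyer.BirchSwinnertonDyer.Theorems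

/-- **v25 STUB (ALG) BY NAME** — `stub_kummerPoleValuesAlgebraic : UDCKummerWitnessLine.KummerPoleValuesAlgebraic`
(C3 LEAD p1 g15, skeleton `Line-kato-shift-three-v25`, registered 2026-08-29T15:53Z), the registered signature verbatim.
[cite: ShimuraIATAF1971, §6.2 Prop. 6.9 and Thm. 7.14] -/
theorem stub_kummerPoleValuesAlgebraic : UDCKummerWitnessLine.KummerPoleValuesAlgebraic :=
  ManinLocalTwoThree.ParamPoleJ.kummerPoleValuesAlgebraic_holds

end Summit.BirchSwinnertonDyer.BirchSwinnertonDyer.Theorems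

end
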